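import Summits.HodgeConjecture.HodgeConjecture.Theorems.Ring2AbelianAllAndreProductPencils
import Literature.AlgebraicGeometry.HodgeTheory.SpecialisationMapComplexPoints
import HarnessLib

/-!
# Ring 2 · sub-cell AbelianAll (ALL ABELIAN VARIETIES), André axis, part XXXIII-a — RETRACTS OF PENCILS: the Gysin padding of
# part XXXII-a runs along EVERY `S`-retract `𝒳 ⟶σ 𝒴 ⟶π 𝒳` (`σ ≫ π = 𝟙`) of a smooth projective family `f : 𝒳 ⟶ S` inside a
# bigger family `π ≫ f : 𝒴 ⟶ S`: `σ_! W` has THE SAME ALGEBRAICITY LOCUS as `W`, and `π_!` brings lifts and transports of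
# `𝒴 ⟶ S` (degree `2(p + r)`) down to `f` (degree `2p`) — fact-free; part XXXII-a is the constant retract `𝒴 = B × 𝒳`, part
# XXXIII-b the new instances (fibre products `𝒳 ×_S 𝒴` of pencils over a common base, fibre squares `𝒳 ×_S 𝒳`)

HONEST FRAMING (page 1, verbatim): **research route, not a corollary; conditional on HC_CM plus one named
minimal statement.** Cell line: research route conditional on HC_CM; not a corollary; Q11.4-sentence-2 already
refuted in dim ≥ 3. Nothing in this file proves a case of the Hodge conjecture for an abelian variety; `HC_CM`, `HC_AV`
do not occur; no node is born (0 `def`), no named fact is used, no `sorry`; axioms standard; nothing is claimed minimal.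

## What this part does (brief (ii): "restrict the class of auxiliary varieties")

Part XXXII-a padded a pencil `f : 𝒳 ⟶ S` by a CONSTANT factor, `B × 𝒳 ⟶ S`, through the slice `σ = (b₀, 𝟙)` and the
projection `pr`, and showed that the André-axis statements of the padded pencil in degree `2(p + dim B)` give those of
`f` in degree `2p`. The two ingredients were `pr ∘ σ = 𝟙` and two base-change identities for the Gysin maps at the
fibres. This part observes that NOTHING ELSE was used: for every pair of `S`-morphisms

  `σ : 𝒳 ⟶ 𝒴`, `π : 𝒴 ⟶ 𝒳`, `σ ≫ π = 𝟙 𝒳` (an `S`-RETRACT; the bigger family is `π ≫ f : 𝒴 ⟶ S`),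

with `𝒳`, `𝒴` smooth projective of dimensions `N`, `r + N` and `f`, `π ≫ f` smooth projective families of relative
dimensions `d`, `r + d` over a separated base, and for the Gysin morphisms `σ_!`, `π_!` (the tree's `complexGysin`,
any orientation family):

* §1 the slice and the projection restrict to the fibres: `π_s : 𝒴_s ⟶ 𝒳_s` is the tree's `Motives.fiberOverMap π f s`,
  and a slice `σ_s : 𝒳_s ⟶ 𝒴_s` with `σ_s ≫ J_s = j_s ≫ σ` EXISTS (`exists_fiberSlice`, universal property of
  `𝒴_s = 𝒴 ×_S s`); both incidence conditions of Fulton's clean base change are exhausted by the fibres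
  (`retract_proj_incidence`, `retract_slice_incidence`: a point of `𝒴` over a point of `𝒳_s` lies in `𝒴_s`; a point of
  `𝒳` whose slice lies in `𝒴_s` lies in `𝒳_s`, because `f = σ ≫ π ≫ f`).
* §2 `proj_gysin_slice_gysin` — `π_! σ_! = id`; `exists_map_fiberι_proj_gysin_eq_smul` — BASE CHANGE FOR THE PROJECTION
  `j_s^* π_! = c · π_{s!} J_s^*`, and `exists_map_fiberι_slice_gysin_eq_smul` — BASE CHANGE FOR THE SLICE
  `J_s^* σ_! = K · σ_{s!} j_s^*`, BOTH instances of the tree's PROVED clean-intersection base change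
  `complexGysin_cleanBaseChange` (Fulton Thm. 6.2 (a); the squares `𝒴_s = 𝒴 ×_𝒳 𝒳_s` along `π` and `𝒳_s = 𝒳 ×_𝒴 𝒴_s`
  along `σ` are cartesian of the expected dimensions); hence `π_!` / `σ_!` preserve "dies on the fibre over `s`" and "is
  algebraic on the fibre over `s`", and **`σ_! W` is algebraic on `𝒴_s` iff `W` is algebraic on `𝒳_s`**
  (`map_fiberι_slice_gysin_mem_iff`) — the two algebraicity loci coincide, for every `s`. The scalars `c`, `K` never matter.
* §3 **`comap_le_comap_of_retract`** — transport from `t` to `s` in degree `2(p + r)` along `π ≫ f` gives transport from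
  `t` to `s` in degree `2p` along `f`; **`comap_le_sup_of_retract`** — the LIFT `(L)_t(p + r)` of `π ≫ f` gives the lift
  `(L)_t(p)` of `f` (`σ_! W = η + κ ⟹ W = π_! η + π_! κ`); `comap_eq_sup_of_retract` — the fixed-part form.

So the André-axis content of a pencil is DOMINATED by that of every pencil of which it is an `S`-retract, degree shifted
by the codimension `r`; the LEVEL `d - p` (the dimension of the cycles on the fibre) is preserved by every such padding.
Part XXXII-a is the instance `𝒴 = B × 𝒳`, `π = pr`, `σ = (b₀, 𝟙)` (its theorems are NOT restated here; e.g.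
`comap_le_sup_of_snd_comp` is `comap_le_sup_of_retract` at that retract, up to the chart `B × 𝒳_s ≅ (B × 𝒳)_s`). Part
XXXIII-b constructs the NON-constant instances: the fibre product `𝒳 ×_S 𝒴 ⟶ S` of two compact pencils of abelian
varieties over the same curve retracts onto `𝒳` through the zero section of `𝒴`, in particular the fibre square
`𝒳 ×_S 𝒳 ⟶ S` (relative dimension `2d`, degree shift `d`: every cell `(d, p)` of `f` is carried to `(2d, p + d)`, AT OR
ABOVE the middle of the square).

What is NOT claimed: any converse (the statements of `𝒴 ⟶ S` in degree `2(p + r)` are in general STRONGER: the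
invariant algebraic classes of `𝒴_t` outside `σ_{t!} H(𝒳_t) + ker π_{t!}`-type positions — e.g. the COUPLED classes
`H^a(𝒳_t) ⊗ H^b(𝒴_t)`, `a, b > 0`, of a fibre product — are new content, part XXXIII-b); anything about `HC_CM`; any
case of HC. EDGE LABELS: every row K (kernel, fact-free).

References: Fulton1998 (Prop. 1.7, Thm. 6.2 (a), Prop. 6.3, §10.1, §19.2); FultonYoungTableaux1997 (App. B §B.1 (4)–(7));
BrosnanFangNiePearlstein2009 (§6 Lemma 48); Milne2020HodgeClassesAV (Prop. 1, p. 7); Abdulali1994FamiliesAV ((1.1)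
p. 1122); Andre1996Motifs (§5.1 p. 25, §6.3 footnote (2) p. 31); Hartshorne1977 (II.3 p. 89, III Prop. 10.1);
VoisinHodgeII2003 (§9.2.4 Prop. 9.21 (ii)).
-/

noncomputable section

set_option linter.dupNamespace false

namespace Summit.HodgeConjecture.HodgeConjecture.Ring2.AbelianAll

open CategoryTheory CategoryTheory.Limits AlgebraicGeometry MonoidalCategory CartesianMonoidalCategory
open Literature.AlgebraicGeometry Literature.AlgebraicGeometry.Motives
open Literature.AlgebraicGeometry.HodgeTheory

variable {𝒳 𝒴 S : SchemeOver ℂ}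

/-! ## §1 Retracts over `S`: the slice and the projection on the fibres, and the two incidence conditions -/

/-- **The slice restricts to the fibres**: for `σ : 𝒳 ⟶ 𝒴`, `π : 𝒴 ⟶ 𝒳` with `σ ≫ π = 𝟙` and the family `f : 𝒳 ⟶ S`,
there is `σ_s : 𝒳_s ⟶ 𝒴_s` (the fibre of `π ≫ f` over `s`) with `σ_s ≫ J_s = j_s ≫ σ` — the universal property of
`𝒴_s = 𝒴 ×_S s`, since `(j_s ≫ σ) ≫ π ≫ f = j_s ≫ f` factors through `s`. [cite: Hartshorne1977, II.3 (p. 89)] -/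
theorem exists_fiberSlice (f : 𝒳 ⟶ S) {π : 𝒴 ⟶ 𝒳} {σ : 𝒳 ⟶ 𝒴} (hσπ : σ ≫ π = 𝟙 𝒳) (s : ComplexPoints S) :
    ∃ σs : fiberOver f s ⟶ fiberOver (π ≫ f) s, σs ≫ fiberι (π ≫ f) s = fiberι f s ≫ σ := by
  have hsq : IsPullback (fiberι (π ≫ f) s) (fiberOverToSpec (π ≫ f) s) (π ≫ f) s :=
    familyPullback.isPullback (π ≫ f) s
  have hcomm : (fiberι f s ≫ σ) ≫ π ≫ f = fiberOverToSpec f s ≫ s := by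
    rw [Category.assoc, reassoc_of% hσπ]
    exact fiberι_comp f s
  exact ⟨hsq.lift (fiberι f s ≫ σ) (fiberOverToSpec f s) hcomm, hsq.lift_fst _ _ hcomm⟩

/-- A slice on the fibre is a section of the projection on the fibre: `σ_s ≫ π_s = 𝟙` (checked after the closed
immersion `j_s`). [folklore] -/
theorem fiberSlice_comp_fiberOverMap [IsSeparated S.hom] (f : 𝒳 ⟶ S) {π : 𝒴 ⟶ 𝒳} {σ : 𝒳 ⟶ 𝒴} (hσπ : σ ≫ π = 𝟙 𝒳)
    (s : ComplexPoints S) {σs : fiberOver f s ⟶ fiberOver (π ≫ f) s} (hσs : σs ≫ fiberι (π ≫ f) s = fiberι f s ≫ σ) :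
    σs ≫ fiberOverMap π f s = 𝟙 (fiberOver f s) := by
  haveI : IsClosedImmersion (fiberι f s).left := by
    haveI : IsClosedImmersion s.left := Motives.CurveNet.isClosedImmersion_left_of_isSeparated s
    rw [fiberι_left]
    exact MorphismProperty.pullback_fst (P := @IsClosedImmersion) _ _ inferInstance
  haveI : Mono (fiberι f s) := (Over.forget _).mono_of_mono_map (inferInstanceAs (Mono (fiberι f s).left))
  rw [← cancel_mono (fiberι f s), Category.assoc, fiberOverMap_comp_fiberι, reassoc_of% hσs, hσπ, Category.comp_id,
    Category.id_comp]

/-- **Incidence for the projection square** (`𝒴_s ⟶ 𝒴` over `𝒳_s ⟶ 𝒳` along `π`): a point `P` of `𝒴` with `π(P) = j_s(Q)`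
lies over `s`, i.e. `P = J_s(R)` with `π_s(R) = Q`. [cite: Fulton1998, Thm. 6.2 (a)] -/
theorem retract_proj_incidence [IsSeparated S.hom] (f : 𝒳 ⟶ S) (π : 𝒴 ⟶ 𝒳) (s : ComplexPoints S) (P : ComplexPoints 𝒴)
    (Q : ComplexPoints (fiberOver f s)) (hPQ : AlgPoints.map π P = AlgPoints.map (fiberι f s) Q) :
    ∃ R : ComplexPoints (fiberOver (π ≫ f) s),
      AlgPoints.map (fiberι (π ≫ f) s) R = P ∧ AlgPoints.map (fiberOverMap π f s) R = Q := by
  haveI : IsClosedImmersion (fiberι f s).left := by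
    haveI : IsClosedImmersion s.left := Motives.CurveNet.isClosedImmersion_left_of_isSeparated s
    rw [fiberι_left]
    exact MorphismProperty.pullback_fst (P := @IsClosedImmersion) _ _ inferInstance
  have hs : P ∈ AlgPoints.map (π ≫ f) ⁻¹' {s} := by
    change AlgPoints.map (π ≫ f) P = s
    rw [AlgPoints.map_comp_apply, hPQ, AlgPoints.map_map_fiberι]
  rw [← AlgPoints.range_map_fiberι] at hs
  obtain ⟨R, hR⟩ := hs
  refine ⟨R, hR, AlgPoints.map_injective (fiberι f s) ?_⟩
  rw [AlgPoints.map_fiberι_map_fiberOverMap, hR, hPQ]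

/-- **Incidence for the slice square** (`𝒳_s ⟶ 𝒳` over `𝒴_s ⟶ 𝒴` along `σ`): a point `P` of `𝒳` with `σ(P) = J_s(Q)`
lies over `s` (apply `π ≫ f` and use `σ ≫ π = 𝟙`), i.e. `P = j_s(R)` with `σ_s(R) = Q`. [cite: Fulton1998, Thm. 6.2 (a)] -/
theorem retract_slice_incidence [IsSeparated S.hom] (f : 𝒳 ⟶ S) {π : 𝒴 ⟶ 𝒳} {σ : 𝒳 ⟶ 𝒴} (hσπ : σ ≫ π = 𝟙 𝒳)
    (s : ComplexPoints S) {σs : fiberOver f s ⟶ fiberOver (π ≫ f) s} (hσs : σs ≫ fiberι (π ≫ f) s = fiberι f s ≫ σ)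
    (P : ComplexPoints 𝒳) (Q : ComplexPoints (fiberOver (π ≫ f) s))
    (hPQ : AlgPoints.map σ P = AlgPoints.map (fiberι (π ≫ f) s) Q) :
    ∃ R : ComplexPoints (fiberOver f s), AlgPoints.map (fiberι f s) R = P ∧ AlgPoints.map σs R = Q := by
  haveI : IsClosedImmersion (fiberι (π ≫ f) s).left := by
    haveI : IsClosedImmersion s.left := Motives.CurveNet.isClosedImmersion_left_of_isSeparated s
    rw [fiberι_left]
    exact MorphismProperty.pullback_fst (P := @IsClosedImmersion) _ _ inferInstance
  have hs : P ∈ AlgPoints.map f ⁻¹' {s} := by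
    change AlgPoints.map f P = s
    have h : AlgPoints.map f P = AlgPoints.map (π ≫ f) (AlgPoints.map σ P) := by
      rw [← AlgPoints.map_comp_apply, reassoc_of% hσπ]
    rw [h, hPQ, AlgPoints.map_map_fiberι]
  rw [← AlgPoints.range_map_fiberι] at hs
  obtain ⟨R, hR⟩ := hs
  refine ⟨R, hR, AlgPoints.map_injective (fiberι (π ≫ f) s) ?_⟩
  rw [← AlgPoints.map_comp_apply, hσs, AlgPoints.map_comp_apply, hR, hPQ]

/-! ## §2 The Gysin padding `σ_!`, `π_!` along an `S`-retract of smooth projective families -/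

section Engine

variable {N d r : ℕ} {f : 𝒳 ⟶ S} {π : 𝒴 ⟶ 𝒳} {σ : 𝒳 ⟶ 𝒴} (μ : OrientationFamily) (hX : IsSmoothProjective N 𝒳)
  (hP : IsSmoothProjective (r + N) 𝒴) (hf : IsSmoothProjectiveFamily f d) (hF : IsSmoothProjectiveFamily (π ≫ f) (r + d))
  (hσπ : σ ≫ π = 𝟙 𝒳)

include hσπ in
/-- **`π_! σ_! = id`** (functoriality of the Gysin morphisms and `σ ≫ π = 𝟙`). [folklore] -/
theorem proj_gysin_slice_gysin (p : ℕ) (W : complexBetti 𝒳 (2 * p)) :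
    complexGysin μ hP hX π (show 2 * (p + r) + 2 * N = 2 * p + 2 * (r + N) by omega)
      (complexGysin μ hX hP σ (show 2 * p + 2 * (r + N) = 2 * (p + r) + 2 * N by omega) W) = W := by
  have hμ : μ.HasPoincareDuality := OrientationFamily.hasPoincareDuality μ
  rw [← LinearMap.comp_apply, ← complexGysin_comp hμ hX hP hX σ π
    (show 2 * p + 2 * (r + N) = 2 * (p + r) + 2 * N by omega) (show 2 * (p + r) + 2 * N = 2 * p + 2 * (r + N) by omega)]
  simp only [hσπ]
  rw [complexGysin_id hμ hX, LinearMap.id_apply]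

variable [IsSeparated S.hom]

include hf hF in
/-- **Base change for the projection** (the cartesian square `𝒴_s ⟶ 𝒴` over `𝒳_s ⟶ 𝒳` along `π`, of the expected
dimensions `(r + d) + N = (r + N) + d`): restricting `π_! u` to `𝒳_s` is, up to ONE scalar, `π_{s!}(J_s^* u)` — the tree's
PROVED `complexGysin_cleanBaseChange` (Fulton Thm. 6.2 (a)), the incidence being `retract_proj_incidence`.
[cite: Fulton1998, Thm. 6.2 (a) and Prop. 1.7] -/
theorem exists_map_fiberι_proj_gysin_eq_smul (s : ComplexPoints S) :
    ∃ c : ℂ, ∀ ⦃k k₁ : ℕ⦄ (hk : k + 2 * N = k₁ + 2 * (r + N)) (u : complexBetti 𝒴 k),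
      complexBetti.map (fiberι f s) k₁ (complexGysin μ hP hX π hk u) =
        c • complexGysin μ (hF.isSmoothProjective s) (hf.isSmoothProjective s) (fiberOverMap π f s)
          (show k + 2 * d = k₁ + 2 * (r + d) by omega) (complexBetti.map (fiberι (π ≫ f) s) k u) := by
  haveI : IsClosedImmersion (fiberι (π ≫ f) s).left := by
    haveI : IsClosedImmersion s.left := Motives.CurveNet.isClosedImmersion_left_of_isSeparated s
    rw [fiberι_left]
    exact MorphismProperty.pullback_fst (P := @IsClosedImmersion) _ _ inferInstance
  haveI := isClosedImmersion_lift_left_of_isSmoothProjective (hf.isSmoothProjective s) (fiberι (π ≫ f) s)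
    (fiberOverMap π f s)
  exact complexGysin_cleanBaseChange μ hP hX (hf.isSmoothProjective s) (hF.isSmoothProjective s) π (fiberι f s)
    (fiberι (π ≫ f) s) (fiberOverMap π f s) (by omega) (retract_proj_incidence f π s)

include hf hF in
/-- `π_!` maps the classes dying on `𝒴_s` into the classes dying on `𝒳_s`. [cite: Fulton1998, Thm. 6.2 (a)] -/
theorem map_fiberι_proj_gysin_eq_zero (s : ComplexPoints S) {k k₁ : ℕ} (hk : k + 2 * N = k₁ + 2 * (r + N))
    {u : complexBetti 𝒴 k} (hu : complexBetti.map (fiberι (π ≫ f) s) k u = 0) :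
    complexBetti.map (fiberι f s) k₁ (complexGysin μ hP hX π hk u) = 0 := by
  obtain ⟨c, hc⟩ := exists_map_fiberι_proj_gysin_eq_smul μ hX hP hf hF s
  rw [hc hk u, hu, map_zero, smul_zero]

include hf hF in
/-- `π_!` maps a class ALGEBRAIC on `𝒴_s` to a class algebraic on `𝒳_s` (base change, then the Gysin morphism of
`π_s : 𝒴_s ⟶ 𝒳_s` preserves algebraic classes). [cite: Fulton1998, Thm. 6.2 (a)] [cite: VoisinHodgeII2003, §9.2.4 Prop. 9.21 (ii)] -/
theorem map_fiberι_proj_gysin_mem_algebraicClasses (s : ComplexPoints S) {p : ℕ} {u : complexBetti 𝒴 (2 * (p + r))}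
    (hu : complexBetti.map (fiberι (π ≫ f) s) (2 * (p + r)) u ∈ algebraicClasses (fiberOver (π ≫ f) s) (p + r)) :
    complexBetti.map (fiberι f s) (2 * p)
        (complexGysin μ hP hX π (show 2 * (p + r) + 2 * N = 2 * p + 2 * (r + N) by omega) u) ∈
      algebraicClasses (fiberOver f s) p := by
  obtain ⟨c, hc⟩ := exists_map_fiberι_proj_gysin_eq_smul μ hX hP hf hF s
  rw [hc]
  exact Submodule.smul_mem _ c
    (complexGysin_mem_algebraicClasses_of_mem_algebraicClasses μ (hF.isSmoothProjective s) (hf.isSmoothProjective s)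
      (fiberOverMap π f s) (show 2 * (p + r) + 2 * d = 2 * p + 2 * (r + d) by omega) hu)

include hf hF hσπ in
/-- **Base change for the slice** (the cartesian square `𝒳_s ⟶ 𝒳` over `𝒴_s ⟶ 𝒴` along `σ`, of the expected dimensions
`d + (r + N) = N + (r + d)`): restricting `σ_! y` to `𝒴_s` is, up to ONE scalar, `σ_{s!}(j_s^* y)` for any slice `σ_s` on
the fibre (`σ_s ≫ J_s = j_s ≫ σ`) — the tree's PROVED `complexGysin_cleanBaseChange`, the incidence being
`retract_slice_incidence`. [cite: Fulton1998, Thm. 6.2 (a) and Prop. 1.7] -/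
theorem exists_map_fiberι_slice_gysin_eq_smul (s : ComplexPoints S) {σs : fiberOver f s ⟶ fiberOver (π ≫ f) s}
    (hσs : σs ≫ fiberι (π ≫ f) s = fiberι f s ≫ σ) :
    ∃ K : ℂ, ∀ ⦃a b : ℕ⦄ (hab : a + 2 * (r + N) = b + 2 * N) (y : complexBetti 𝒳 a),
      complexBetti.map (fiberι (π ≫ f) s) b (complexGysin μ hX hP σ hab y) =
        K • complexGysin μ (hf.isSmoothProjective s) (hF.isSmoothProjective s) σs
          (show a + 2 * (r + d) = b + 2 * d by omega) (complexBetti.map (fiberι f s) a y) := by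
  haveI : IsClosedImmersion (fiberι f s).left := by
    haveI : IsClosedImmersion s.left := Motives.CurveNet.isClosedImmersion_left_of_isSeparated s
    rw [fiberι_left]
    exact MorphismProperty.pullback_fst (P := @IsClosedImmersion) _ _ inferInstance
  haveI := isClosedImmersion_lift_left_of_isSmoothProjective (hF.isSmoothProjective s) (fiberι f s) σs
  exact complexGysin_cleanBaseChange μ hX hP (hF.isSmoothProjective s) (hf.isSmoothProjective s) σ (fiberι (π ≫ f) s)
    (fiberι f s) σs (by omega) (retract_slice_incidence f hσπ s hσs)

include hf hF hσπ in
/-- `σ_!` maps the classes dying on `𝒳_s` into the classes dying on `𝒴_s`. [cite: Fulton1998, Thm. 6.2 (a)] -/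
theorem map_fiberι_slice_gysin_eq_zero (s : ComplexPoints S) {a b : ℕ} (hab : a + 2 * (r + N) = b + 2 * N)
    {y : complexBetti 𝒳 a} (hy : complexBetti.map (fiberι f s) a y = 0) :
    complexBetti.map (fiberι (π ≫ f) s) b (complexGysin μ hX hP σ hab y) = 0 := by
  obtain ⟨σs, hσs⟩ := exists_fiberSlice f hσπ s
  obtain ⟨K, hK⟩ := exists_map_fiberι_slice_gysin_eq_smul μ hX hP hf hF hσπ s hσs
  rw [hK hab y, hy, map_zero, smul_zero]

include hf hF hσπ in
/-- `σ_!` maps a class algebraic on `𝒳_s` to a class algebraic on `𝒴_s`. [cite: Fulton1998, Thm. 6.2 (a)]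
[cite: VoisinHodgeII2003, §9.2.4 Prop. 9.21 (ii)] -/
theorem map_fiberι_slice_gysin_mem_algebraicClasses (s : ComplexPoints S) {p : ℕ} {y : complexBetti 𝒳 (2 * p)}
    (hy : complexBetti.map (fiberι f s) (2 * p) y ∈ algebraicClasses (fiberOver f s) p) :
    complexBetti.map (fiberι (π ≫ f) s) (2 * (p + r))
        (complexGysin μ hX hP σ (show 2 * p + 2 * (r + N) = 2 * (p + r) + 2 * N by omega) y) ∈
      algebraicClasses (fiberOver (π ≫ f) s) (p + r) := by
  obtain ⟨σs, hσs⟩ := exists_fiberSlice f hσπ s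
  obtain ⟨K, hK⟩ := exists_map_fiberι_slice_gysin_eq_smul μ hX hP hf hF hσπ s hσs
  rw [hK]
  exact Submodule.smul_mem _ K
    (complexGysin_mem_algebraicClasses_of_mem_algebraicClasses μ (hf.isSmoothProjective s) (hF.isSmoothProjective s) σs
      (show 2 * p + 2 * (r + d) = 2 * (p + r) + 2 * d by omega) hy)

include hf hF hσπ in
/-- **THE TWO ALGEBRAICITY LOCI COINCIDE**: for every `s`, `σ_! W` is algebraic on `𝒴_s` iff `W` is algebraic on `𝒳_s`
(`⟸`: base change for the slice; `⟹`: `W = π_! σ_! W` and base change for the projection). No Lefschetz operator, no moving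
lemma, no named fact. [cite: Fulton1998, Prop. 1.7 and Thm. 6.2 (a)] [cite: BrosnanFangNiePearlstein2009, §6 Lemma 48] -/
theorem map_fiberι_slice_gysin_mem_iff (s : ComplexPoints S) (p : ℕ) (W : complexBetti 𝒳 (2 * p)) :
    complexBetti.map (fiberι (π ≫ f) s) (2 * (p + r))
        (complexGysin μ hX hP σ (show 2 * p + 2 * (r + N) = 2 * (p + r) + 2 * N by omega) W) ∈
        algebraicClasses (fiberOver (π ≫ f) s) (p + r) ↔
      complexBetti.map (fiberι f s) (2 * p) W ∈ algebraicClasses (fiberOver f s) p := by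
  refine ⟨fun h ↦ ?_, map_fiberι_slice_gysin_mem_algebraicClasses μ hX hP hf hF hσπ s⟩
  have h' := map_fiberι_proj_gysin_mem_algebraicClasses μ hX hP hf hF s h
  rwa [proj_gysin_slice_gysin μ hX hP hσπ] at h'

include hf hF hσπ in
/-- **THE ALGEBRAICITY LOCI OF `W` (for `f`) AND OF `σ_! W` (for `π ≫ f`) COINCIDE as subsets of `S(ℂ)`.** FACT-FREE.
[cite: Fulton1998, Prop. 1.7 and Thm. 6.2 (a)] [cite: BrosnanFangNiePearlstein2009, §6 Lemma 48] -/
theorem setOf_map_fiberι_slice_gysin_mem_eq (p : ℕ) (W : complexBetti 𝒳 (2 * p)) :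
    {s : ComplexPoints S | complexBetti.map (fiberι (π ≫ f) s) (2 * (p + r))
        (complexGysin μ hX hP σ (show 2 * p + 2 * (r + N) = 2 * (p + r) + 2 * N by omega) W) ∈
        algebraicClasses (fiberOver (π ≫ f) s) (p + r)} =
      {s : ComplexPoints S | complexBetti.map (fiberι f s) (2 * p) W ∈ algebraicClasses (fiberOver f s) p} :=
  Set.ext fun s ↦ map_fiberι_slice_gysin_mem_iff μ hX hP hf hF hσπ s p W

end Engine

/-! ## §3 Pointwise consequences: transport, lift and fixed part descend from `π ≫ f` to its retract `f` -/

section Pointwise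

variable {N d r : ℕ} {f : 𝒳 ⟶ S} {π : 𝒴 ⟶ 𝒳} {σ : 𝒳 ⟶ 𝒴} (hX : IsSmoothProjective N 𝒳)
  (hP : IsSmoothProjective (r + N) 𝒴) (hf : IsSmoothProjectiveFamily f d) (hF : IsSmoothProjectiveFamily (π ≫ f) (r + d))
  (hσπ : σ ≫ π = 𝟙 𝒳)

variable [IsSeparated S.hom]

include hX hP hf hF hσπ in
/-- **TRANSPORT along `π ≫ f` in degree `2(p + r)` gives transport along `f` in degree `2p`** (same two points `t`, `s`):
if every class of `𝒴` algebraic on `𝒴_t` is algebraic on `𝒴_s`, then every class of `𝒳` algebraic on `𝒳_t` is algebraic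
on `𝒳_s` (`W ↦ σ_! W`, loci coincide). FACT-FREE. [cite: Fulton1998, Prop. 1.7 and Thm. 6.2 (a)]
[cite: Abdulali1994FamiliesAV, (1.1) (p. 1122)] -/
theorem comap_le_comap_of_retract {t s : ComplexPoints S} {p : ℕ}
    (h : (algebraicClasses (fiberOver (π ≫ f) t) (p + r)).comap (complexBetti.map (fiberι (π ≫ f) t) (2 * (p + r))).hom ≤
      (algebraicClasses (fiberOver (π ≫ f) s) (p + r)).comap (complexBetti.map (fiberι (π ≫ f) s) (2 * (p + r))).hom) :
    (algebraicClasses (fiberOver f t) p).comap (complexBetti.map (fiberι f t) (2 * p)).hom ≤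
      (algebraicClasses (fiberOver f s) p).comap (complexBetti.map (fiberι f s) (2 * p)).hom := fun W hW ↦
  let μ : OrientationFamily := fun _ _ h ↦ (Motives.ComplexPoints.isOrientableOver ℂ h).some
  (map_fiberι_slice_gysin_mem_iff μ hX hP hf hF hσπ s p W).1
    (h ((map_fiberι_slice_gysin_mem_iff μ hX hP hf hF hσπ t p W).2 hW))

include hX hP hf hF hσπ in
/-- **THE LIFT `(L)_t(p + r)` of `π ≫ f` gives the lift `(L)_t(p)` of `f`** (lattice form, same point `t`): if
`(J_t^*)⁻¹ N^{p+r}(𝒴_t) ≤ N^{p+r}(𝒴) ⊔ ker J_t^*` then `(j_t^*)⁻¹ Nᵖ(𝒳_t) ≤ Nᵖ(𝒳) ⊔ ker j_t^*`: for `W` algebraic on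
`𝒳_t`, `σ_! W` is algebraic on `𝒴_t`, so `σ_! W = η + κ` with `η` algebraic on `𝒴` and `κ` dying on `𝒴_t`; then
`W = π_! σ_! W = π_! η + π_! κ` with `π_! η` algebraic on `𝒳` and `π_! κ` dying on `𝒳_t`. FACT-FREE.
[cite: Fulton1998, Prop. 1.7 and Thm. 6.2 (a)] [cite: Milne2020HodgeClassesAV, Prop. 1 (p. 7)] -/
theorem comap_le_sup_of_retract {t : ComplexPoints S} {p : ℕ}
    (h : (algebraicClasses (fiberOver (π ≫ f) t) (p + r)).comap (complexBetti.map (fiberι (π ≫ f) t) (2 * (p + r))).hom ≤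
      algebraicClasses 𝒴 (p + r) ⊔ LinearMap.ker (complexBetti.map (fiberι (π ≫ f) t) (2 * (p + r))).hom) :
    (algebraicClasses (fiberOver f t) p).comap (complexBetti.map (fiberι f t) (2 * p)).hom ≤
      algebraicClasses 𝒳 p ⊔ LinearMap.ker (complexBetti.map (fiberι f t) (2 * p)).hom := by
  intro W hW
  let μ : OrientationFamily := fun _ _ h ↦ (Motives.ComplexPoints.isOrientableOver ℂ h).some
  obtain ⟨η, hη, κ, hκ, hsum⟩ := Submodule.mem_sup.1 (h ((map_fiberι_slice_gysin_mem_iff μ hX hP hf hF hσπ t p W).2 hW))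
  rw [← proj_gysin_slice_gysin μ hX hP hσπ p W, ← hsum, map_add]
  refine Submodule.add_mem_sup ?_ ?_
  · exact complexGysin_mem_algebraicClasses_of_mem_algebraicClasses μ hP hX π _ hη
  · rw [LinearMap.mem_ker] at hκ ⊢
    exact map_fiberι_proj_gysin_eq_zero μ hX hP hf hF t _ hκ

include hX hP hf hF hσπ in
/-- **The algebraic fixed part in degree `2(p + r)` on `π ≫ f` gives it in degree `2p` on `f`** (lattice identity at
`t`), granted that algebraic classes of `𝒳` restrict to algebraic classes of `𝒳_t` (a hypothesis here; the tree's
theorem `map_fiberι_mem_algebraicClasses` on quasi-projective carriers). FACT-FREE. [cite: Milne2020HodgeClassesAV, Prop. 1 (p. 7)]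
[cite: Fulton1998, Prop. 1.7 and §10.1] -/
theorem comap_eq_sup_of_retract {t : ComplexPoints S} {p : ℕ}
    (hres : ∀ η ∈ algebraicClasses 𝒳 p, complexBetti.map (fiberι f t) (2 * p) η ∈ algebraicClasses (fiberOver f t) p)
    (h : (algebraicClasses (fiberOver (π ≫ f) t) (p + r)).comap (complexBetti.map (fiberι (π ≫ f) t) (2 * (p + r))).hom =
      algebraicClasses 𝒴 (p + r) ⊔ LinearMap.ker (complexBetti.map (fiberι (π ≫ f) t) (2 * (p + r))).hom) :
    (algebraicClasses (fiberOver f t) p).comap (complexBetti.map (fiberι f t) (2 * p)).hom =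
      algebraicClasses 𝒳 p ⊔ LinearMap.ker (complexBetti.map (fiberι f t) (2 * p)).hom := by
  refine le_antisymm (comap_le_sup_of_retract hX hP hf hF hσπ h.le) (sup_le (fun η hη ↦ hres η hη) fun κ hκ ↦ ?_)
  rw [LinearMap.mem_ker] at hκ
  change complexBetti.map (fiberι f t) (2 * p) κ ∈ algebraicClasses (fiberOver f t) p
  rw [hκ]
  exact Submodule.zero_mem _

include hX hP hf hF hσπ in
/-- **The single-class transport form**: if `σ_! W`-type statements are not wanted, read §2 classwise — a class `W` of `𝒳`
is algebraic on exactly the fibres `𝒳_s` over the points `s` where `σ_! W` is algebraic on `𝒴_s`; in particular, if EVERY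
class of `𝒴` of degree `2(p + r)` algebraic on `𝒴_t` is algebraic on all fibres of `π ≫ f`, then every class of `𝒳` of
degree `2p` algebraic on `𝒳_t` is algebraic on all fibres of `f`. FACT-FREE. [cite: Abdulali1994FamiliesAV, (1.1) (p. 1122)] -/
theorem forall_map_fiberι_mem_of_retract {t : ComplexPoints S} {p : ℕ}
    (h : ∀ U : complexBetti 𝒴 (2 * (p + r)),
      complexBetti.map (fiberι (π ≫ f) t) (2 * (p + r)) U ∈ algebraicClasses (fiberOver (π ≫ f) t) (p + r) →
        ∀ s : ComplexPoints S,
          complexBetti.map (fiberι (π ≫ f) s) (2 * (p + r)) U ∈ algebraicClasses (fiberOver (π ≫ f) s) (p + r))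
    (W : complexBetti 𝒳 (2 * p)) (hW : complexBetti.map (fiberι f t) (2 * p) W ∈ algebraicClasses (fiberOver f t) p)
    (s : ComplexPoints S) : complexBetti.map (fiberι f s) (2 * p) W ∈ algebraicClasses (fiberOver f s) p :=
  comap_le_comap_of_retract hX hP hf hF hσπ (t := t) (s := s) (p := p) (fun U hU ↦ h U hU s) hW

end Pointwise

end Summit.HodgeConjecture.HodgeConjecture.Ring2.AbelianAll

end
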